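import Summits.CriticalPhenomena.Ising3DConformalLimit.Theses.CanonicalBranchRefutation
import Summits.CriticalPhenomena.Ising3DConformalLimit.Theses.AnomalousForcesInteraction
import Summits.CriticalPhenomena.Ising3DConformalLimit.Theorems.CanonicalBranchRefutationInfraredExponentZeroSphereMassDeaveraging
import Literature.Probability.LatticeModels.CriticalTwoPointBounds
import Literature.Probability.LatticeModels.CorrelationDecayProofs
import HarnessLib

/-!
# Route `CanonicalBranchRefutation`, crux `InfraredExponentZero` (stmt-CriticalPhenomena-15521), line
# `registered`: the critical sphere masses `M(n) = ∑_{y ∈ ∂Λ_n} ⟨σ₀σ_y⟩⁺_{β_c}` on `ℤ³`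

Helper file (`--supports stmt-CriticalPhenomena-15521`) of the line lead. The line
(`Cruxes/InfraredExponentZero/Lines/birth.lean`) cuts the crux `InfraredExponentZero := HasIsingExponentEta 3 0`
(`log⟨σ₀σ_x⟩_{β_c}/log‖x‖ → -1` along `cofinite` on `ℤ³`; the branch hypothesis of the negation-lens route,
expected FALSE, `η(3) ≈ 0.0363`) into the registered stubs `stub_sphereMass_growth` — THE BET:
`∀ ε > 0, ∀ᶠ n, n^{1-ε} ≤ M(n)` (shell-averaged `η(3) ≤ 0`) — and `stub_sphereMass_deaveraging` (MMS,
`c‖x‖_∞⁻² M(3‖x‖_∞) ≤ ⟨σ₀σ_x⟩`, LANDED: `Theorems/…SphereMassDeaveraging.lean`). Proved here, unconditionally: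
* `sq_le_card_sphere_three` / `card_sphere_three_le`: `n² ≤ #∂Λ_n ≤ 54 n²` (`n ≥ 1`);
* `sphereMass_growth_of_infraredExponentZero`: the CONVERSE of the line, crux ⇒ bet (the crux gives
  `‖x‖^{-(1+ε)} ≤ ⟨σ₀σ_x⟩` off a finite set, and `#∂Λ_n ≥ n²`);
* `sphereMass_window`: the rigorous window `c ≤ M(n) ≤ C n` from the tree's two-point bounds
  `c‖x‖⁻² ≤ ⟨σ₀σ_x⟩_{β_c} ≤ C‖x‖⁻¹` (`criticalTwoPoint_bounds_holds`, Duminil-Copin 2019 Thm. 4.8: Simon–Lieb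
  floor, Fröhlich–Simon–Spencer infrared ceiling) — the averaged exponent is only known to lie in `[0, 1]`;
* `hasSpatialDecayExponent_one_of_envelopes` (ε-squeeze) and `infraredExponentZero_of_sphereMass_growth`:
  the line's ASSEMBLY with its second hypothesis discharged by the landed de-averaging: bet ⇒ crux;
* `infraredExponentZero_iff_sphereMass_growth`: **crux ⇔ bet** — the registered stub is EQUIVALENT to the
  crux, hence crux-sized (the open problem itself; no print proves or refutes it, Duminil-Copin ICM 2022 §4.2.1);
* `not_infraredExponentZero_of_frequently_sphereMass_lt`, `not_infraredExponentZero_of_etaPositive`: refuter's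
  forms — the crux dies with `M(n_k) ≤ n_k^{1-δ}` along a sequence, in particular with the crux
  `AnomalousForcesInteraction.EtaPositive` (`⟨σ₀σ_x⟩ ≤ C‖x‖^{-(1+κ)}`, `κ > 0`: kill criterion (a) of the
  route). NOTE: `PerfectScreening.NonSaturation`/`ScreeningUpgrade` (`‖x‖⟨σ₀σ_x⟩ → 0`) do NOT by themselves
  refute the log-sense crux (`1/(‖x‖ log ‖x‖)` has logarithmic exponent exactly `1`).

References: H. Duminil-Copin, *Lectures on the Ising and Potts models on the hypercubic lattice* (2019),
Thm. 4.8 and §4.3 eq. (4.10); S. Friedli, Y. Velenik, *Statistical Mechanics of Lattice Systems* (2017),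
§3.10.11 (logarithmic exponents); H. Duminil-Copin, ICM 2022, §4.2.1 (η(3) open).
-/

namespace Summit.CriticalPhenomena.Ising3DConformalLimit.Theorems

open Filter Topology Finset Literature.Probability.LatticeModels

/-- **Shell count from below on `ℤ³`**: `#∂Λ_{k+1} = (2k+3)³ - (2k+1)³ = 24k² + 48k + 26 ≥ (k+1)²`.
[folklore] -/
theorem sq_le_card_sphere_three (k : ℕ) : (k + 1) ^ 2 ≤ #(sphere 3 (k + 1)) := by
  have h := card_sphere_succ_add (d := 3) k
  rw [card_box, card_box] at h
  nlinarith [h]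

/-- **Shell count from above on `ℤ³`**: `#∂Λ_{k+1} ≤ 6 (2k+3)² ≤ 54 (k+1)²`
(`card_sphere_succ_le`). [folklore] -/
theorem card_sphere_three_le (k : ℕ) : (#(sphere 3 (k + 1)) : ℝ) ≤ 54 * ((k : ℝ) + 1) ^ 2 := by
  have hcard := card_sphere_succ_le (d := 3) k
  norm_num at hcard
  have hk : (0 : ℝ) ≤ (k : ℝ) := Nat.cast_nonneg k
  have h9 : (2 * (k : ℝ) + 3) ^ 2 ≤ 9 * ((k : ℝ) + 1) ^ 2 := by nlinarith [hk]
  nlinarith [hcard, h9]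

/-- **The crux implies the bet (converse of line `registered`).** If
`log⟨σ₀σ_x⟩_{β_c}/log‖x‖ → -1` on `ℤ³` (`InfraredExponentZero = HasIsingExponentEta 3 0`), then for
every `ε > 0` the critical sphere masses satisfy `n^{1-ε} ≤ M(n) = ∑_{y ∈ ∂Λ_n} ⟨σ₀σ_y⟩⁺_{β_c}` for all
large `n`: the limit gives `‖x‖^{-(1+ε)} ≤ ⟨σ₀σ_x⟩` off a finite exceptional set (`⟨σ₀σ_x⟩ > 0` by the
Simon–Lieb floor of `criticalTwoPoint_bounds_holds`), whose sup norms are bounded, and `#∂Λ_n ≥ n²`.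
The conclusion is VERBATIM the registered stub `stub_sphereMass_growth` of crux
stmt-CriticalPhenomena-15521. [folklore] -/
theorem sphereMass_growth_of_infraredExponentZero
    (h : Summit.CriticalPhenomena.Ising3DConformalLimit.Theses.CanonicalBranchRefutation.InfraredExponentZero) :
    ∀ ε : ℝ, 0 < ε → ∀ᶠ n : ℕ in atTop,
      (n : ℝ) ^ (1 - ε) ≤ ∑ y ∈ sphere 3 n, criticalTwoPoint 3 y := by
  intro ε hε
  -- the crux, unfolded: `log G / log ‖x‖ → -1` along `cofinite`
  have hlim : Tendsto (fun x : Site 3 => Real.log (criticalTwoPoint 3 x) / Real.log ‖x‖)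
      cofinite (𝓝 (-1)) := by
    have h' : HasSpatialDecayExponent (criticalTwoPoint 3) (((3 : ℕ) : ℝ) - 2 + 0) := h
    have e : (((3 : ℕ) : ℝ) - 2 + 0) = 1 := by norm_num
    rw [e] at h'
    exact h'
  obtain ⟨c, C, hc, hbd⟩ := criticalTwoPoint_bounds_holds (d := 3) le_rfl
  -- eventually (cofinite) the clean pointwise lower bound `‖x‖^{-(1+ε)} ≤ G x`
  have hev : ∀ᶠ x : Site 3 in cofinite, ‖x‖ ^ (-(1 + ε)) ≤ criticalTwoPoint 3 x := by
    have h1 : ∀ᶠ x : Site 3 in cofinite,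
        -(1 + ε) < Real.log (criticalTwoPoint 3 x) / Real.log ‖x‖ :=
      hlim.eventually (Ioi_mem_nhds (by linarith))
    filter_upwards [h1, Site.tendsto_norm_cofinite_atTop.eventually_gt_atTop 1] with x hx hx1
    have hxpos : 0 < ‖x‖ := by linarith
    have hlogx : 0 < Real.log ‖x‖ := Real.log_pos hx1
    have hx0 : x ≠ 0 := by
      rintro rfl
      rw [norm_zero] at hx1
      linarith
    have hGpos : 0 < criticalTwoPoint 3 x :=
      lt_of_lt_of_le (mul_pos hc (Real.rpow_pos_of_pos hxpos _)) (hbd x hx0).1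
    have h2 : -(1 + ε) * Real.log ‖x‖ < Real.log (criticalTwoPoint 3 x) := (lt_div_iff₀ hlogx).1 hx
    rw [← Real.log_rpow hxpos] at h2
    exact ((Real.log_lt_log_iff (Real.rpow_pos_of_pos hxpos _) hGpos).1 h2).le
  -- the finite exceptional set has bounded sup norm `≤ N₀`
  rw [Filter.eventually_cofinite] at hev
  set E : Finset (Site 3) := hev.toFinset with hE
  set N₀ : ℕ := E.sup Site.supNorm with hN₀
  have hgood : ∀ y : Site 3, N₀ < Site.supNorm y → ‖y‖ ^ (-(1 + ε)) ≤ criticalTwoPoint 3 y := by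
    intro y hy
    by_contra hcon
    have hyE : y ∈ E := hev.mem_toFinset.2 hcon
    have hle : Site.supNorm y ≤ N₀ := Finset.le_sup (f := Site.supNorm) hyE
    omega
  rw [eventually_atTop]
  refine ⟨N₀ + 1, fun n hn => ?_⟩
  obtain ⟨k, rfl⟩ : ∃ k, n = k + 1 := ⟨n - 1, by omega⟩
  have hnpos : (0 : ℝ) < ((k + 1 : ℕ) : ℝ) := by positivity
  -- every site of the shell carries at least `n^{-(1+ε)}`
  have hterm : ∀ y ∈ sphere 3 (k + 1),
      ((k + 1 : ℕ) : ℝ) ^ (-(1 + ε)) ≤ criticalTwoPoint 3 y := by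
    intro y hy
    have hyn : Site.supNorm y = k + 1 := mem_sphere.1 hy
    have hy' := hgood y (by omega)
    rwa [Site.norm_eq_supNorm, hyn] at hy'
  have hcard : ((k + 1 : ℕ) : ℝ) ^ 2 ≤ (#(sphere 3 (k + 1)) : ℝ) := by
    exact_mod_cast sq_le_card_sphere_three k
  calc ((k + 1 : ℕ) : ℝ) ^ (1 - ε)
      = ((k + 1 : ℕ) : ℝ) ^ 2 * ((k + 1 : ℕ) : ℝ) ^ (-(1 + ε)) := by
        rw [show (1 - ε : ℝ) = 2 + -(1 + ε) by ring, Real.rpow_add hnpos, Real.rpow_two]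
    _ ≤ (#(sphere 3 (k + 1)) : ℝ) * ((k + 1 : ℕ) : ℝ) ^ (-(1 + ε)) :=
        mul_le_mul_of_nonneg_right hcard (Real.rpow_nonneg hnpos.le _)
    _ = ∑ _y ∈ sphere 3 (k + 1), ((k + 1 : ℕ) : ℝ) ^ (-(1 + ε)) := by
        rw [Finset.sum_const, nsmul_eq_mul]
    _ ≤ ∑ y ∈ sphere 3 (k + 1), criticalTwoPoint 3 y := Finset.sum_le_sum hterm

/-- **The rigorous window for the bet.** There are `0 < c` and `C` with `c ≤ M(n) ≤ C n` for every
`n ≥ 1`, where `M(n) = ∑_{y ∈ ∂Λ_n} ⟨σ₀σ_y⟩⁺_{β_c}` on `ℤ³`: sum the tree's two-point bounds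
`c₀‖y‖⁻² ≤ ⟨σ₀σ_y⟩_{β_c} ≤ C₀‖y‖⁻¹` (`criticalTwoPoint_bounds_holds`, Duminil-Copin 2019 Thm. 4.8:
Simon–Lieb floor, Fröhlich–Simon–Spencer infrared ceiling) over the shell `‖y‖_∞ = n`, with
`n² ≤ #∂Λ_n ≤ 54 n²`. So the averaged exponent in `M(n) ≈ n^{1-η}` is only known to satisfy
`0 ≤ 1 - η ≤ 1`; the registered stub `stub_sphereMass_growth` bets on the endpoint `1`.
[cite: DuminilCopin2019, Thm. 4.8, §4.4] -/
theorem sphereMass_window : ∃ c C : ℝ, 0 < c ∧ ∀ n : ℕ, 1 ≤ n →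
    c ≤ ∑ y ∈ sphere 3 n, criticalTwoPoint 3 y ∧
      ∑ y ∈ sphere 3 n, criticalTwoPoint 3 y ≤ C * n := by
  obtain ⟨c, C, hc, hbd⟩ := criticalTwoPoint_bounds_holds (d := 3) le_rfl
  refine ⟨c, 54 * max C 0, hc, fun n hn => ?_⟩
  obtain ⟨k, rfl⟩ : ∃ k, n = k + 1 := ⟨n - 1, by omega⟩
  have hnpos : (0 : ℝ) < ((k + 1 : ℕ) : ℝ) := by positivity
  have hne : ∀ y ∈ sphere 3 (k + 1), y ≠ 0 := by
    intro y hy h0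
    have hyn : Site.supNorm y = k + 1 := mem_sphere.1 hy
    rw [h0, Site.supNorm_eq_zero_iff.2 rfl] at hyn
    omega
  have hnorm : ∀ y ∈ sphere 3 (k + 1), ‖y‖ = ((k + 1 : ℕ) : ℝ) := by
    intro y hy
    rw [Site.norm_eq_supNorm, mem_sphere.1 hy]
  have hcard_lo : ((k + 1 : ℕ) : ℝ) ^ 2 ≤ (#(sphere 3 (k + 1)) : ℝ) := by
    exact_mod_cast sq_le_card_sphere_three k
  have hcard_hi : (#(sphere 3 (k + 1)) : ℝ) ≤ 54 * ((k + 1 : ℕ) : ℝ) ^ 2 := by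
    have := card_sphere_three_le k
    push_cast at this ⊢
    exact this
  have e2 : ((k + 1 : ℕ) : ℝ) ^ (-(((3 : ℕ) : ℝ) - 1)) = (((k + 1 : ℕ) : ℝ) ^ 2)⁻¹ := by
    rw [show (-(((3 : ℕ) : ℝ) - 1)) = -(2 : ℝ) by norm_num, Real.rpow_neg hnpos.le, Real.rpow_two]
  have e1 : ((k + 1 : ℕ) : ℝ) ^ (-(((3 : ℕ) : ℝ) - 2)) = (((k + 1 : ℕ) : ℝ))⁻¹ := by
    rw [show (-(((3 : ℕ) : ℝ) - 2)) = -(1 : ℝ) by norm_num, Real.rpow_neg hnpos.le, Real.rpow_one]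
  constructor
  · -- floor: each term is `≥ c n⁻²` and there are `≥ n²` terms
    have hterm : ∀ y ∈ sphere 3 (k + 1), c * (((k + 1 : ℕ) : ℝ) ^ 2)⁻¹ ≤ criticalTwoPoint 3 y := by
      intro y hy
      have h := (hbd y (hne y hy)).1
      rwa [hnorm y hy, e2] at h
    calc c = ((k + 1 : ℕ) : ℝ) ^ 2 * (c * (((k + 1 : ℕ) : ℝ) ^ 2)⁻¹) := by
          field_simp
      _ ≤ (#(sphere 3 (k + 1)) : ℝ) * (c * (((k + 1 : ℕ) : ℝ) ^ 2)⁻¹) :=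
          mul_le_mul_of_nonneg_right hcard_lo (by positivity)
      _ = ∑ _y ∈ sphere 3 (k + 1), c * (((k + 1 : ℕ) : ℝ) ^ 2)⁻¹ := by
          rw [Finset.sum_const, nsmul_eq_mul]
      _ ≤ ∑ y ∈ sphere 3 (k + 1), criticalTwoPoint 3 y := Finset.sum_le_sum hterm
  · -- ceiling: each term is `≤ max C 0 · n⁻¹` and there are `≤ 54 n²` terms
    have hterm : ∀ y ∈ sphere 3 (k + 1),
        criticalTwoPoint 3 y ≤ max C 0 * (((k + 1 : ℕ) : ℝ))⁻¹ := by
      intro y hy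
      have h := (hbd y (hne y hy)).2
      rw [hnorm y hy, e1] at h
      exact h.trans (mul_le_mul_of_nonneg_right (le_max_left _ _) (by positivity))
    calc ∑ y ∈ sphere 3 (k + 1), criticalTwoPoint 3 y
        ≤ ∑ _y ∈ sphere 3 (k + 1), max C 0 * (((k + 1 : ℕ) : ℝ))⁻¹ := Finset.sum_le_sum hterm
      _ = (#(sphere 3 (k + 1)) : ℝ) * (max C 0 * (((k + 1 : ℕ) : ℝ))⁻¹) := by
          rw [Finset.sum_const, nsmul_eq_mul]
      _ ≤ 54 * ((k + 1 : ℕ) : ℝ) ^ 2 * (max C 0 * (((k + 1 : ℕ) : ℝ))⁻¹) :=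
          mul_le_mul_of_nonneg_right hcard_hi (by positivity)
      _ = 54 * max C 0 * ((k + 1 : ℕ) : ℝ) := by
          field_simp

/-! ### The line's assembly with the landed de-averaging stub: bet ⇒ crux, and crux ⇔ bet -/

/-- **Squeeze for logarithmic exponents.** If `G ≤ C‖x‖⁻¹` eventually and, for every `ε > 0`,
`c_ε ‖x‖^{-(1+ε)} ≤ G` eventually along `cofinite` on `ℤ³` (`c_ε > 0`), then `log G(x) / log ‖x‖ → -1`,
i.e. `HasSpatialDecayExponent G 1` (ε-version of the tree's `IsPowerBounded.hasSpatialDecayExponent_holds`;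
this is the glue lemma of the skeleton `Cruxes/InfraredExponentZero/Lines/birth.lean`). [folklore] -/
theorem hasSpatialDecayExponent_one_of_envelopes {G : Site 3 → ℝ}
    (hup : ∃ C : ℝ, ∀ᶠ x : Site 3 in cofinite, G x ≤ C * ‖x‖ ^ (-(1 : ℝ)))
    (hlow : ∀ ε : ℝ, 0 < ε → ∃ c : ℝ, 0 < c ∧
      ∀ᶠ x : Site 3 in cofinite, c * ‖x‖ ^ (-(1 + ε)) ≤ G x) :
    HasSpatialDecayExponent G 1 := by
  unfold HasSpatialDecayExponent
  have hnorm := Site.tendsto_norm_cofinite_atTop (d := 3)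
  have hlog : Tendsto (fun x : Site 3 => Real.log ‖x‖) cofinite atTop :=
    Real.tendsto_log_atTop.comp hnorm
  have hev1 : ∀ᶠ x : Site 3 in cofinite, 1 < ‖x‖ := hnorm.eventually_gt_atTop 1
  have hconst : ∀ K κ : ℝ,
      Tendsto (fun x : Site 3 => Real.log K / Real.log ‖x‖ + (-κ)) cofinite (𝓝 (-κ)) := by
    intro K κ
    simpa using (hlog.const_div_atTop (Real.log K)).add_const (-κ)
  rw [tendsto_order]
  constructor
  · -- lower side: for `a < -1`, eventually `a < log G / log ‖x‖`
    intro a ha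
    set κ : ℝ := 1 + (-1 - a) / 2 with hκ
    have hεpos : 0 < (-1 - a) / 2 := by linarith
    have hgt : a < -κ := by rw [hκ]; linarith
    obtain ⟨c, hc, hlowc⟩ := hlow ((-1 - a) / 2) hεpos
    filter_upwards [(hconst c κ).eventually_const_lt hgt, hlowc, hev1] with x hx hGx hx1
    have hxpos : 0 < ‖x‖ := by linarith
    have hlogx : 0 < Real.log ‖x‖ := Real.log_pos hx1
    have hpow : 0 < ‖x‖ ^ (-κ) := Real.rpow_pos_of_pos hxpos _
    have hGx' : c * ‖x‖ ^ (-κ) ≤ G x := by rw [hκ]; exact hGx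
    have hGpos : 0 < G x := (mul_pos hc hpow).trans_le hGx'
    have hle : Real.log c + (-κ) * Real.log ‖x‖ ≤ Real.log (G x) := by
      rw [← Real.log_rpow hxpos, ← Real.log_mul hc.ne' hpow.ne']
      exact Real.log_le_log (mul_pos hc hpow) hGx'
    refine hx.trans_le ?_
    rw [div_add' _ _ _ hlogx.ne', div_le_div_iff_of_pos_right hlogx]
    linarith
  · -- upper side: for `b > -1`, eventually `log G / log ‖x‖ < b`
    intro b hb
    obtain ⟨C, hupC⟩ := hup
    obtain ⟨c, hc, hlowc⟩ := hlow 1 one_pos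
    have hCpos : 0 < max C 1 := lt_max_of_lt_right one_pos
    filter_upwards [(hconst (max C 1) 1).eventually_lt_const hb, hupC, hlowc, hev1] with
      x hx hGx hGlow hx1
    have hxpos : 0 < ‖x‖ := by linarith
    have hlogx : 0 < Real.log ‖x‖ := Real.log_pos hx1
    have hpow1 : 0 < ‖x‖ ^ (-(1 : ℝ)) := Real.rpow_pos_of_pos hxpos _
    have hpow2 : 0 < ‖x‖ ^ (-(1 + 1 : ℝ)) := Real.rpow_pos_of_pos hxpos _
    have hGpos : 0 < G x := (mul_pos hc hpow2).trans_le hGlow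
    have hGx' : G x ≤ max C 1 * ‖x‖ ^ (-(1 : ℝ)) :=
      hGx.trans (mul_le_mul_of_nonneg_right (le_max_left _ _) hpow1.le)
    have hle : Real.log (G x) ≤ Real.log (max C 1) + (-(1 : ℝ)) * Real.log ‖x‖ := by
      rw [← Real.log_rpow hxpos, ← Real.log_mul hCpos.ne' hpow1.ne']
      exact Real.log_le_log hGpos hGx'
    refine lt_of_le_of_lt ?_ hx
    rw [div_add' _ _ _ hlogx.ne', div_le_div_iff_of_pos_right hlogx]
    linarith

/-- **The bet implies the crux** (the assembly `InfraredExponentZero_of` of line `registered`, with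
its second hypothesis DISCHARGED by the landed stub `stub_sphereMass_deaveraging`): if the critical
sphere masses on `ℤ³` satisfy `n^{1-ε} ≤ M(n)` eventually for every `ε > 0`, then
`log⟨σ₀σ_x⟩_{β_c}/log‖x‖ → -1`, i.e. `InfraredExponentZero = HasIsingExponentEta 3 0`. De-averaging
turns the growth into the lower envelope `c_ε ‖x‖^{-(1+ε)} ≤ ⟨σ₀σ_x⟩` (cofinitely), the tree's infrared
ceiling `⟨σ₀σ_x⟩ ≤ C‖x‖⁻¹` (`criticalTwoPoint_bounds_holds`) is the upper envelope, and the squeeze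
gives exponent `1 = 3 - 2 + 0`. The hypothesis is VERBATIM the registered stub `stub_sphereMass_growth`.
[cite: DuminilCopin2019, Thm. 4.8, §4.4] -/
theorem infraredExponentZero_of_sphereMass_growth
    (h_growth : ∀ ε : ℝ, 0 < ε → ∀ᶠ n : ℕ in atTop,
      (n : ℝ) ^ (1 - ε) ≤ ∑ y ∈ sphere 3 n, criticalTwoPoint 3 y) :
    Summit.CriticalPhenomena.Ising3DConformalLimit.Theses.CanonicalBranchRefutation.InfraredExponentZero := by
  -- Step 1: the lower envelope `c ‖x‖^{-(1+ε)} ≤ G x`, eventually, for every `ε > 0`.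
  have hlowenv : ∀ ε : ℝ, 0 < ε → ∃ c : ℝ, 0 < c ∧
      ∀ᶠ x : Site 3 in cofinite, c * ‖x‖ ^ (-(1 + ε)) ≤ criticalTwoPoint 3 x := by
    intro ε hε
    obtain ⟨c, hc, hdeav⟩ := stub_sphereMass_deaveraging
    obtain ⟨N, hN⟩ := eventually_atTop.1 (h_growth ε hε)
    refine ⟨c * (3 : ℝ) ^ (1 - ε), by positivity, ?_⟩
    -- eventually (cofinite) `‖x‖_∞ ≥ max N 1`: the exceptional set lies in the finite box `Λ_{max N 1}`
    have hev : ∀ᶠ x : Site 3 in cofinite, max N 1 ≤ Site.supNorm x := by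
      rw [eventually_cofinite]
      refine (box 3 (max N 1)).finite_toSet.subset fun x hx => ?_
      rw [Set.mem_setOf_eq, not_le] at hx
      rw [Finset.mem_coe, mem_box_iff_supNorm_le]
      exact hx.le
    filter_upwards [hev] with x hx
    have hxN : N ≤ Site.supNorm x := le_of_max_le_left hx
    have hx1 : 1 ≤ Site.supNorm x := le_of_max_le_right hx
    have hx0 : x ≠ 0 := by
      intro h0
      rw [← Site.supNorm_eq_zero_iff] at h0
      omega
    have hmpos : (0 : ℝ) < (Site.supNorm x : ℝ) := by exact_mod_cast hx1
    have h3m : N ≤ 3 * Site.supNorm x := by omega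
    have hmass : ((3 * Site.supNorm x : ℕ) : ℝ) ^ (1 - ε) ≤
        ∑ y ∈ sphere 3 (3 * Site.supNorm x), criticalTwoPoint 3 y := hN _ h3m
    have hdx := hdeav x hx0
    have hnorm : ‖x‖ = (Site.supNorm x : ℝ) := Site.norm_eq_supNorm x
    rw [hnorm]
    have hsplit : (Site.supNorm x : ℝ) ^ (-(1 + ε)) =
        ((Site.supNorm x : ℝ) ^ 2)⁻¹ * (Site.supNorm x : ℝ) ^ (1 - ε) := by
      rw [show (-(1 + ε) : ℝ) = (1 - ε) + -2 by ring, Real.rpow_add hmpos,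
        Real.rpow_neg hmpos.le, Real.rpow_two]
      ring
    calc c * (3 : ℝ) ^ (1 - ε) * (Site.supNorm x : ℝ) ^ (-(1 + ε))
        = c * ((Site.supNorm x : ℝ) ^ 2)⁻¹ *
            ((3 : ℝ) ^ (1 - ε) * (Site.supNorm x : ℝ) ^ (1 - ε)) := by
          rw [hsplit]; ring
      _ ≤ c * ((Site.supNorm x : ℝ) ^ 2)⁻¹ *
            (∑ y ∈ sphere 3 (3 * Site.supNorm x), criticalTwoPoint 3 y) := by
          apply mul_le_mul_of_nonneg_left _ (by positivity)
          calc (3 : ℝ) ^ (1 - ε) * (Site.supNorm x : ℝ) ^ (1 - ε)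
              = ((3 * Site.supNorm x : ℕ) : ℝ) ^ (1 - ε) := by
                rw [Nat.cast_mul, Nat.cast_ofNat, Real.mul_rpow (by norm_num) hmpos.le]
            _ ≤ _ := hmass
      _ ≤ criticalTwoPoint 3 x := hdx
  -- Step 2: the infrared ceiling from the tree (Duminil-Copin 2019 Thm. 4.8, `d = 3`).
  obtain ⟨c₀, C₀, -, hbounds⟩ := criticalTwoPoint_bounds_holds (d := 3) le_rfl
  have hup : ∃ C : ℝ, ∀ᶠ x : Site 3 in cofinite, criticalTwoPoint 3 x ≤ C * ‖x‖ ^ (-(1 : ℝ)) := by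
    refine ⟨C₀, ?_⟩
    filter_upwards [eventually_cofinite_ne (0 : Site 3)] with x hx
    have hb := (hbounds x hx).2
    have hexp : (-(((3 : ℕ) : ℝ) - 2)) = (-(1 : ℝ)) := by norm_num
    rwa [hexp] at hb
  -- Step 3: squeeze, and `3 - 2 + 0 = 1`.
  have key : HasSpatialDecayExponent (criticalTwoPoint 3) 1 :=
    hasSpatialDecayExponent_one_of_envelopes hup hlowenv
  show HasIsingExponentEta 3 0
  unfold HasIsingExponentEta
  have h1 : ((3 : ℕ) : ℝ) - 2 + 0 = 1 := by norm_num
  rw [h1]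
  exact key

/-- **Crux ⇔ bet.** The crux `InfraredExponentZero` (`η(3) = 0` in the logarithmic sense) holds iff
the critical sphere masses `M(n) = ∑_{y ∈ ∂Λ_n} ⟨σ₀σ_y⟩⁺_{β_c}` on `ℤ³` satisfy
`∀ ε > 0, ∀ᶠ n, n^{1-ε} ≤ M(n)` — the registered stub `stub_sphereMass_growth` of line `registered`,
verbatim. So that stub is exactly crux-sized: it is the open problem itself in shell-averaged form
(rigorously `c ≤ M(n) ≤ C n` only, `sphereMass_window`; expected false, `M(n) ≈ n^{1-η}`,
`η(3) ≈ 0.0363`), and a refuter kills the crux by exhibiting `δ > 0` and `n_k → ∞` with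
`M(n_k) ≤ n_k^{1-δ}`. [folklore] -/
theorem infraredExponentZero_iff_sphereMass_growth :
    Summit.CriticalPhenomena.Ising3DConformalLimit.Theses.CanonicalBranchRefutation.InfraredExponentZero ↔
      ∀ ε : ℝ, 0 < ε → ∀ᶠ n : ℕ in atTop,
        (n : ℝ) ^ (1 - ε) ≤ ∑ y ∈ sphere 3 n, criticalTwoPoint 3 y :=
  ⟨sphereMass_growth_of_infraredExponentZero, infraredExponentZero_of_sphereMass_growth⟩

/-- **Refuter's form.** The crux fails as soon as the sphere masses dip below a power `n^{1-δ}`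
(`δ > 0`) along an unbounded set of radii: `(∃ δ > 0, ∃ᶠ n, M(n) < n^{1-δ}) → ¬ InfraredExponentZero`.
[folklore] -/
theorem not_infraredExponentZero_of_frequently_sphereMass_lt
    (h : ∃ δ : ℝ, 0 < δ ∧ ∃ᶠ n : ℕ in atTop,
      ∑ y ∈ sphere 3 n, criticalTwoPoint 3 y < (n : ℝ) ^ (1 - δ)) :
    ¬ Summit.CriticalPhenomena.Ising3DConformalLimit.Theses.CanonicalBranchRefutation.InfraredExponentZero := by
  rintro hcrux
  obtain ⟨δ, hδ, hfreq⟩ := h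
  exact hfreq (by simpa only [not_lt] using sphereMass_growth_of_infraredExponentZero hcrux δ hδ)

/-- **Kill criterion (a) of the route, first disjunct, as a theorem**: the crux
`AnomalousForcesInteraction.EtaPositive` (item stmt-CriticalPhenomena-2600: `⟨σ₀σ_x⟩⁺_{β_c(3)} ≤ C‖x‖^{-(1+κ)}`
for some `κ > 0` and all `x ≠ 0`) refutes `InfraredExponentZero`: it caps the sphere masses by
`M(n) ≤ 54 C n^{1-κ}` (`#∂Λ_n ≤ 54 n²`), against the growth `M(n) ≥ n^{1-κ/2}` the crux would give.
[folklore] -/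
theorem not_infraredExponentZero_of_etaPositive
    (hpos : Summit.CriticalPhenomena.Ising3DConformalLimit.Theses.AnomalousForcesInteraction.EtaPositive) :
    ¬ Summit.CriticalPhenomena.Ising3DConformalLimit.Theses.CanonicalBranchRefutation.InfraredExponentZero := by
  intro hcrux
  obtain ⟨κ, C, hκ, hbd⟩ := hpos
  have hgrowth := sphereMass_growth_of_infraredExponentZero hcrux (κ / 2) (by linarith)
  -- eventually `54 (max C 0) n^{1-κ} < n^{1-κ/2}`
  have hev : ∀ᶠ n : ℕ in atTop, 54 * max C 0 * (n : ℝ) ^ (1 - κ) < (n : ℝ) ^ (1 - κ / 2) := by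
    have ht : Tendsto (fun n : ℕ => (n : ℝ) ^ (κ / 2)) atTop atTop :=
      (tendsto_rpow_atTop (by linarith)).comp tendsto_natCast_atTop_atTop
    filter_upwards [ht.eventually_gt_atTop (54 * max C 0), eventually_ge_atTop 1] with n hn hn1
    have hn0 : (0 : ℝ) < n := by exact_mod_cast hn1
    calc 54 * max C 0 * (n : ℝ) ^ (1 - κ) < (n : ℝ) ^ (κ / 2) * (n : ℝ) ^ (1 - κ) :=
          mul_lt_mul_of_pos_right hn (Real.rpow_pos_of_pos hn0 _)
      _ = (n : ℝ) ^ (1 - κ / 2) := by rw [← Real.rpow_add hn0]; ring_nf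
  obtain ⟨n, hn_growth, hn_lt, hn1⟩ := (hgrowth.and (hev.and (eventually_ge_atTop 1))).exists
  -- while `EtaPositive` caps `M(n) ≤ 54 (max C 0) n^{1-κ}`
  obtain ⟨k, rfl⟩ : ∃ k, n = k + 1 := ⟨n - 1, by omega⟩
  have hnpos : (0 : ℝ) < ((k + 1 : ℕ) : ℝ) := by positivity
  have hterm : ∀ y ∈ sphere 3 (k + 1),
      criticalTwoPoint 3 y ≤ max C 0 * ((k + 1 : ℕ) : ℝ) ^ (-(1 + κ)) := by
    intro y hy
    have hyn : Site.supNorm y = k + 1 := mem_sphere.1 hy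
    have hy0 : y ≠ 0 := by
      intro h0
      rw [h0, Site.supNorm_eq_zero_iff.2 rfl] at hyn
      omega
    have h := hbd y hy0
    rw [Site.norm_eq_supNorm, hyn] at h
    exact h.trans (mul_le_mul_of_nonneg_right (le_max_left _ _) (Real.rpow_nonneg hnpos.le _))
  have hM : ∑ y ∈ sphere 3 (k + 1), criticalTwoPoint 3 y ≤
      54 * max C 0 * ((k + 1 : ℕ) : ℝ) ^ (1 - κ) := by
    calc ∑ y ∈ sphere 3 (k + 1), criticalTwoPoint 3 y
        ≤ ∑ _y ∈ sphere 3 (k + 1), max C 0 * ((k + 1 : ℕ) : ℝ) ^ (-(1 + κ)) :=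
          Finset.sum_le_sum hterm
      _ = (#(sphere 3 (k + 1)) : ℝ) * (max C 0 * ((k + 1 : ℕ) : ℝ) ^ (-(1 + κ))) := by
          rw [Finset.sum_const, nsmul_eq_mul]
      _ ≤ 54 * ((k : ℝ) + 1) ^ 2 * (max C 0 * ((k + 1 : ℕ) : ℝ) ^ (-(1 + κ))) :=
          mul_le_mul_of_nonneg_right (card_sphere_three_le k) (by positivity)
      _ = 54 * max C 0 * ((k + 1 : ℕ) : ℝ) ^ (1 - κ) := by
          have e : ((k : ℝ) + 1) = ((k + 1 : ℕ) : ℝ) := by push_cast; ring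
          rw [e, show (1 - κ : ℝ) = 2 + -(1 + κ) by ring, Real.rpow_add hnpos, Real.rpow_two]
          ring
  linarith [hn_growth, hn_lt, hM]

end Summit.CriticalPhenomena.Ising3DConformalLimit.Theorems
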